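import Summits.KontsevichZagierPeriods.Zeta5Search.WedgeDictionaryLevelDescentVFullKernelRatio
import HarnessLib

/-!
# REC-K, interior columns — the WZ pair of the kernel factor and the termwise identity for `x ≤ μ` (PROVED)

HONEST FRAMING: "systematic search; no irrationality claim unless certified".

CREDIT: the telescoper `p₂, p₁, p₀` and the WZ certificate were FOUND and verified exactly by the exactrec engine
(eng-exactrec-1, delivery F-zeta5-CT2, stage `zeta5ct-0.1`, MANIFEST e8bc5dda0b45603e; `recK_verify.py`); the cleared
polynomial identities `recK_interior_cleared` / `recK_col1_cleared` are the engine's `lean/RecKCertificate.lean` verbatim (`ring`).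
The cell's step is re-attaching the hypergeometric term (`kernel5_succ4`) and summing.
PLACEMENT (lead/lit g8, LITERATURE §I.50): `K_μ` is (a Pochhammer multiple of) a terminating very-well-poised ₇F₆(1); by
Whipple's transformation (Andrews–Askey–Roy, Special Functions, Thm 3.4.4) it is a terminating balanced ₄F₃(1) in which `μ`
moves contiguously, so an order-2 recurrence in `μ` exists a priori (Wilson 1977 / Raynal 1979 three-term relations, AAR §3.7);
REC-K is the EXPLICIT Wilson-type three-term relation with its WZ certificate, proved here from scratch.

WZ pair: `F(μ,x) = (μ−1)!(−1)^{x−1}k₅(x)/((μ−x)!(x−1)!(x+N+1)_μ)` (`1 ≤ x ≤ μ`, so `K_μ = Σ_x F(μ,x)`), mate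
`G(μ,x) = −μ(x−1)∏_{j∈B}(x+N−b_j)·(μ−1)!(−1)^{x−1}k₅(x)/((2x+N)(x−1)!(μ+2−x)!(x+N+1)_{μ+1})` (`1 ≤ x ≤ μ+2`; `G(μ,1) = 0`);
termwise `p₂F(μ+2,x) + p₁F(μ+1,x) + p₀F(μ,x) = G(μ,x+1) − G(μ,x)` on `1 ≤ x ≤ μ+2`, with `p₂(μ) = ∏_{j∈B}(μ+N+2−b_j)` (`kerP2`),
`p₀(μ) = μ(μ+2N+1−e₁)` (`kerP0`), `p₁` the cubic `kerP1` (`e_k = e_k(b₃,…,b₆)`).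
This file: the pair, the telescoper, and the interior columns `x = y+1 ≤ μ = y+1+k` (`wz_col_interior`, from
`recK_interior_cleared` after factoring the common unit `wzUnit`).  Boundary columns and the summation:
`WedgeDictionaryLevelDescentVFullRecK`.  Exact cross-checks: pub-zeta5 g9 `e6_recK.py` (T 720/720), `e8_units.py` (1560/1560).
-/

open Finset

namespace Summit.KontsevichZagierPeriods.Zeta5Search.WedgeDictionary

open Summit.KontsevichZagierPeriods.Zeta5Search.DualSeries

/-! ### §2 The WZ pair and the telescoper -/

/-- `F(μ,x) = (μ−1)!(−1)^{x−1}k₅(x)/((μ−x)!(x−1)!(x+N+1)_μ)` for `1 ≤ x ≤ μ`, else `0`. -/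
def wzF (b : ℕ → ℤ) (μ x : ℕ) : ℚ :=
  if 1 ≤ x ∧ x ≤ μ then
    ((μ - 1).factorial : ℚ) * ((-1 : ℚ) ^ (x - 1) * kernel5 b x) /
      (((μ - x).factorial : ℚ) * ((x - 1).factorial : ℚ) * pochQ ((x : ℚ) + b 0 + 1) μ)
  else 0

/-- The WZ mate `G(μ,x)` (module docstring) for `1 ≤ x ≤ μ+2`, else `0`. -/
def wzG (b : ℕ → ℤ) (μ x : ℕ) : ℚ :=
  if 1 ≤ x ∧ x ≤ μ + 2 then
    -((μ : ℚ) * ((x : ℚ) - 1) *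
          (((x : ℚ) + b 0 - b 3) * ((x : ℚ) + b 0 - b 4) * ((x : ℚ) + b 0 - b 5) * ((x : ℚ) + b 0 - b 6)) *
        (((μ - 1).factorial : ℚ) * ((-1 : ℚ) ^ (x - 1) * kernel5 b x))) /
      ((2 * (x : ℚ) + b 0) * ((x - 1).factorial : ℚ) * ((μ + 2 - x).factorial : ℚ) * pochQ ((x : ℚ) + b 0 + 1) (μ + 1))
  else 0

/-- `e₁(B) = b₃+b₄+b₅+b₆` (as a rational). -/
def esB1 (b : ℕ → ℤ) : ℚ := (b 3 : ℚ) + b 4 + b 5 + b 6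
/-- `e₂(B)`. -/
def esB2 (b : ℕ → ℤ) : ℚ := (b 3 : ℚ) * b 4 + (b 3 : ℚ) * b 5 + (b 3 : ℚ) * b 6 + (b 4 : ℚ) * b 5 + (b 4 : ℚ) * b 6 + (b 5 : ℚ) * b 6
/-- `e₃(B)`. -/
def esB3 (b : ℕ → ℤ) : ℚ := (b 3 : ℚ) * b 4 * b 5 + (b 3 : ℚ) * b 4 * b 6 + (b 3 : ℚ) * b 5 * b 6 + (b 4 : ℚ) * b 5 * b 6

/-- `p₂(μ) = ∏_{j∈B}(μ+N+2−b_j)`. -/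
def kerP2 (b : ℕ → ℤ) (μ : ℕ) : ℚ :=
  ((μ : ℚ) + b 0 + 2 - b 3) * ((μ : ℚ) + b 0 + 2 - b 4) * ((μ : ℚ) + b 0 + 2 - b 5) * ((μ : ℚ) + b 0 + 2 - b 6)

/-- `p₁(μ) = −2μ³ + (−6N+2e₁−8)μ² + (−5N²+3Ne₁−15N+5e₁−e₂−11)μ + (−N³+N²e₁−5N²+3Ne₁−Ne₂−9N+3e₁−e₂+e₃−5)`. -/
def kerP1 (b : ℕ → ℤ) (μ : ℕ) : ℚ :=
  -2 * (μ : ℚ) ^ 3 + (-6 * (b 0 : ℚ) + 2 * esB1 b - 8) * (μ : ℚ) ^ 2 +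
      (-5 * (b 0 : ℚ) ^ 2 + 3 * (b 0 : ℚ) * esB1 b - 15 * (b 0 : ℚ) + 5 * esB1 b - esB2 b - 11) * (μ : ℚ) +
    (-(b 0 : ℚ) ^ 3 + (b 0 : ℚ) ^ 2 * esB1 b - 5 * (b 0 : ℚ) ^ 2 + 3 * (b 0 : ℚ) * esB1 b - (b 0 : ℚ) * esB2 b - 9 * (b 0 : ℚ) +
      3 * esB1 b - esB2 b + esB3 b - 5)

/-- `p₀(μ) = μ(μ+2N+1−e₁)`. -/
def kerP0 (b : ℕ → ℤ) (μ : ℕ) : ℚ := (μ : ℚ) * ((μ : ℚ) + 2 * b 0 + 1 - esB1 b)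

/-! ### §3 The engine's cleared certificate identities (eng-exactrec-1 `RecKCertificate.lean`, verbatim) -/

set_option maxHeartbeats 4000000 in
/-- REC-K certificate, interior columns (cleared form; `ring`).  exactrec (eng-exactrec-1), zeta5ct-0.1. -/
theorem recK_interior_cleared {K : Type*} [Field K] (x μ N b3 b4 b5 b6 : K) :
    let e1 := b3 + b4 + b5 + b6
    let e2 := b3*b4 + b3*b5 + b3*b6 + b4*b5 + b4*b6 + b5*b6
    let e3 := b3*b4*b5 + b3*b4*b6 + b3*b5*b6 + b4*b5*b6
    let p2 := (μ + N + 2 - b3) * (μ + N + 2 - b4) * (μ + N + 2 - b5) * (μ + N + 2 - b6)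
    let p1 := -2*μ^3 + (-6*N + 2*e1 - 8)*μ^2 + (-5*N^2 + 3*N*e1 - 15*N + 5*e1 - e2 - 11)*μ
              + (-N^3 + N^2*e1 - 5*N^2 + 3*N*e1 - N*e2 - 9*N + 3*e1 - e2 + e3 - 5)
    let p0 := μ * (μ + 2*N + 1 - e1)
    let D := (2*x + N) * (x - μ - 1) * (x - μ - 2) * (x + N + 1 + μ) * (x + N + 2 + μ)
    μ * (μ + 1) * p2 * (2*x + N)
      - μ * p1 * (2*x + N) * (x - μ - 2) * (x + N + 2 + μ)
      + p0 * D
      - ( -(μ * (x + N + 1) * ((x + b3) * (x + b4) * (x + b5) * (x + b6)) * (x - μ - 2))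
          + μ * (x - 1) * ((x + N - b3) * (x + N - b4) * (x + N - b5) * (x + N - b6)) * (x + N + 2 + μ) ) = 0 := by
  intro e1 e2 e3 p2 p1 p0 D
  simp only [e1, e2, e3, p2, p1, p0, D]
  ring

/-! ### §4 The termwise identity, column by column -/

/-- The common unit of the interior column `x = y+1 ≤ μ = y+1+k`:
`(μ−1)!(−1)^y k₅(x) / ((μ−x)!(x−1)!(x+N+1)_μ · (x+N+1+μ)(x+N+2+μ)(μ+1−x)(μ+2−x)(2x+N))`. -/
def wzUnit (b : ℕ → ℤ) (y k : ℕ) : ℚ :=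
  ((y + k).factorial : ℚ) * ((-1 : ℚ) ^ y * kernel5 b (y + 1)) /
    ((k.factorial : ℚ) * (y.factorial : ℚ) * pochQ ((y : ℚ) + 1 + b 0 + 1) (y + 1 + k) *
      (((y : ℚ) + 1 + b 0 + 1 + ((y : ℚ) + 1 + k)) * ((y : ℚ) + 1 + b 0 + 2 + ((y : ℚ) + 1 + k)) *
        ((k : ℚ) + 1) * ((k : ℚ) + 2) * (2 * ((y : ℚ) + 1) + b 0)))

section interior
variable (b : ℕ → ℤ) (hN : 0 ≤ b 0) (y k : ℕ)
include hN

/-- `F(μ,x)` over the unit. -/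
theorem wzF_unit0 : wzF b (y + 1 + k) (y + 1) =
    wzUnit b y k * ((2 * ((y : ℚ) + 1) + b 0) * ((y : ℚ) + 1 + b 0 + 1 + ((y : ℚ) + 1 + k)) *
      ((y : ℚ) + 1 + b 0 + 2 + ((y : ℚ) + 1 + k)) * ((k : ℚ) + 1) * ((k : ℚ) + 2)) := by
  have hN' : (0 : ℚ) ≤ b 0 := by exact_mod_cast hN
  have hQ : 0 < pochQ ((y : ℚ) + 1 + b 0 + 1) (y + 1 + k) := pochQ_pos (by positivity) _
  rw [wzF, if_pos ⟨by omega, by omega⟩, wzUnit]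
  have e1 : y + 1 + k - 1 = y + k := by omega
  have e2 : y + 1 + k - (y + 1) = k := by omega
  simp only [e1, e2, Nat.add_sub_cancel]
  push_cast
  rw [div_mul_eq_mul_div, div_eq_div_iff (by positivity) (by positivity)]
  ring

/-- `F(μ+1,x)` over the unit. -/
theorem wzF_unit1 : wzF b (y + 1 + k + 1) (y + 1) =
    wzUnit b y k * (((y : ℚ) + 1 + k) * (2 * ((y : ℚ) + 1) + b 0) * ((y : ℚ) + 1 + b 0 + 2 + ((y : ℚ) + 1 + k)) * ((k : ℚ) + 2)) := by
  have hN' : (0 : ℚ) ≤ b 0 := by exact_mod_cast hN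
  have hQ : 0 < pochQ ((y : ℚ) + 1 + b 0 + 1) (y + 1 + k) := pochQ_pos (by positivity) _
  rw [wzF, if_pos ⟨by omega, by omega⟩, wzUnit]
  have e1 : y + 1 + k + 1 - 1 = y + k + 1 := by omega
  have e2 : y + 1 + k + 1 - (y + 1) = k + 1 := by omega
  simp only [e1, e2, Nat.add_sub_cancel, Nat.factorial_succ, pochQ_succ_right]
  push_cast
  rw [div_mul_eq_mul_div, div_eq_div_iff (by positivity) (by positivity)]
  ring

/-- `F(μ+2,x)` over the unit. -/
theorem wzF_unit2 : wzF b (y + 1 + k + 2) (y + 1) = wzUnit b y k * (((y : ℚ) + 1 + k) * ((y : ℚ) + 1 + k + 1) * (2 * ((y : ℚ) + 1) + b 0)) := by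
  have hN' : (0 : ℚ) ≤ b 0 := by exact_mod_cast hN
  have hQ : 0 < pochQ ((y : ℚ) + 1 + b 0 + 1) (y + 1 + k) := pochQ_pos (by positivity) _
  rw [show y + 1 + k + 2 = y + 1 + k + 1 + 1 from rfl, wzF, if_pos ⟨by omega, by omega⟩, wzUnit]
  have e1 : y + 1 + k + 1 + 1 - 1 = y + k + 1 + 1 := by omega
  have e2 : y + 1 + k + 1 + 1 - (y + 1) = k + 1 + 1 := by omega
  simp only [e1, e2, Nat.add_sub_cancel, Nat.factorial_succ, pochQ_succ_right]
  push_cast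
  rw [div_mul_eq_mul_div, div_eq_div_iff (by positivity) (by positivity)]
  ring

/-- `G(μ,x)` over the unit. -/
theorem wzG_unit0 : wzG b (y + 1 + k) (y + 1) =
    wzUnit b y k * (-(((y : ℚ) + 1 + k) * (((y : ℚ) + 1) - 1) *
      ((((y : ℚ) + 1) + b 0 - b 3) * (((y : ℚ) + 1) + b 0 - b 4) * (((y : ℚ) + 1) + b 0 - b 5) * (((y : ℚ) + 1) + b 0 - b 6)) *
      ((y : ℚ) + 1 + b 0 + 2 + ((y : ℚ) + 1 + k)))) := by
  have hN' : (0 : ℚ) ≤ b 0 := by exact_mod_cast hN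
  have hQ : 0 < pochQ ((y : ℚ) + 1 + b 0 + 1) (y + 1 + k) := pochQ_pos (by positivity) _
  rw [wzG, if_pos ⟨by omega, by omega⟩, wzUnit]
  have e1 : y + 1 + k - 1 = y + k := by omega
  have e2 : y + 1 + k + 2 - (y + 1) = k + 1 + 1 := by omega
  simp only [e1, e2, Nat.add_sub_cancel, Nat.factorial_succ, pochQ_succ_right]
  push_cast
  rw [div_mul_eq_mul_div, div_eq_div_iff (by positivity) (by positivity)]
  -- keep the kernel certificate small: the quartic `B`-product is a common atom of both sides (the
  -- un-generalised `ring` proof exceeded the 12 GB kernel RSS cap on the plain-`lean` build path).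
  generalize ((y : ℚ) + 1 + b 0 - b 3) * ((y : ℚ) + 1 + b 0 - b 4) * ((y : ℚ) + 1 + b 0 - b 5) *
      ((y : ℚ) + 1 + b 0 - b 6) = A
  ring

/-- `G(μ,x+1)` over the unit (uses the kernel ratio `kernel5_succ4` and the base shift of `(x+N+1)_{μ+1}`;
the two quartic `B`-products are generalised before `linear_combination` to keep the normal forms small). -/
theorem wzG_unit1 (hB : ∀ j ∈ Icc 3 6, 0 ≤ b j ∧ b j ≤ b 0) : wzG b (y + 1 + k) (y + 1 + 1) =
    wzUnit b y k * (((y : ℚ) + 1 + k) * (((y : ℚ) + 1) + b 0 + 1) *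
      ((((y : ℚ) + 1) + b 3) * (((y : ℚ) + 1) + b 4) * (((y : ℚ) + 1) + b 5) * (((y : ℚ) + 1) + b 6)) * ((k : ℚ) + 2)) := by
  have hN' : (0 : ℚ) ≤ b 0 := by exact_mod_cast hN
  have hQ : 0 < pochQ ((y : ℚ) + 1 + b 0 + 1) (y + 1 + k) := pochQ_pos (by positivity) _
  have hQ' : 0 < pochQ ((y : ℚ) + 1 + 1 + b 0 + 1) (y + 1 + k + 1) := pochQ_pos (by positivity) _
  have h3' : (b 3 : ℚ) ≤ b 0 := by exact_mod_cast (hB 3 (by simp)).2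
  have h4' : (b 4 : ℚ) ≤ b 0 := by exact_mod_cast (hB 4 (by simp)).2
  have h5' : (b 5 : ℚ) ≤ b 0 := by exact_mod_cast (hB 5 (by simp)).2
  have h6' : (b 6 : ℚ) ≤ b 0 := by exact_mod_cast (hB 6 (by simp)).2
  have hA0 : (0 : ℚ) < ((y : ℚ) + 1 + b 0 + 1 - b 3) * ((y : ℚ) + 1 + b 0 + 1 - b 4) * ((y : ℚ) + 1 + b 0 + 1 - b 5) *
      ((y : ℚ) + 1 + b 0 + 1 - b 6) :=
    mul_pos (mul_pos (mul_pos (by linarith) (by linarith)) (by linarith)) (by linarith)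
  -- the kernel ratio at `x = y+1` and the base shift of the Pochhammer symbol
  have hK := kernel5_succ4 b (y + 1) (by omega) hN hB
  push_cast at hK
  have hP : ((y : ℚ) + 1 + b 0 + 1) * pochQ ((y : ℚ) + 1 + 1 + b 0 + 1) (y + 1 + k + 1) =
      pochQ ((y : ℚ) + 1 + b 0 + 1) (y + 1 + k) * (((y : ℚ) + 1 + b 0 + 1) + ((y : ℚ) + 1 + k)) *
        (((y : ℚ) + 1 + b 0 + 1) + ((y : ℚ) + 1 + k + 1)) := by
    have h := pochQ_shift ((y : ℚ) + 1 + b 0 + 1) (y + 1 + k + 1)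
    rw [show (y : ℚ) + 1 + b 0 + 1 + 1 = (y : ℚ) + 1 + 1 + b 0 + 1 by ring,
      pochQ_succ_right ((y : ℚ) + 1 + b 0 + 1) (y + 1 + k)] at h
    push_cast at h
    linear_combination h
  -- the multiplier clearing both relations
  have hm : (2 * ((y : ℚ) + 1) + b 0) * (((y : ℚ) + 1 + b 0 + 1 - b 3) * ((y : ℚ) + 1 + b 0 + 1 - b 4) *
      ((y : ℚ) + 1 + b 0 + 1 - b 5) * ((y : ℚ) + 1 + b 0 + 1 - b 6)) * ((y : ℚ) + 1 + b 0 + 1) ≠ 0 :=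
    (mul_pos (mul_pos (by positivity) hA0) (by positivity)).ne'
  rw [wzG, if_pos ⟨by omega, by omega⟩, wzUnit]
  have e1 : y + 1 + k - 1 = y + k := by omega
  have e2 : y + 1 + k + 2 - (y + 1 + 1) = k + 1 := by omega
  simp only [e1, e2, Nat.add_sub_cancel, Nat.factorial_succ]
  push_cast
  rw [show (y : ℚ) + 1 + 1 + b 0 - b 3 = (y : ℚ) + 1 + b 0 + 1 - b 3 by ring,
    show (y : ℚ) + 1 + 1 + b 0 - b 4 = (y : ℚ) + 1 + b 0 + 1 - b 4 by ring,
    show (y : ℚ) + 1 + 1 + b 0 - b 5 = (y : ℚ) + 1 + b 0 + 1 - b 5 by ring,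
    show (y : ℚ) + 1 + 1 + b 0 - b 6 = (y : ℚ) + 1 + b 0 + 1 - b 6 by ring,
    div_mul_eq_mul_div, div_eq_div_iff (by positivity) (by positivity)]
  apply mul_left_cancel₀ hm
  generalize ((y : ℚ) + 1 + b 0 + 1 - b 3) * ((y : ℚ) + 1 + b 0 + 1 - b 4) * ((y : ℚ) + 1 + b 0 + 1 - b 5) *
      ((y : ℚ) + 1 + b 0 + 1 - b 6) = A at hK ⊢
  generalize ((y : ℚ) + 1 + b 3) * ((y : ℚ) + 1 + b 4) * ((y : ℚ) + 1 + b 5) * ((y : ℚ) + 1 + b 6) = P at hK ⊢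
  linear_combination
    (((y : ℚ) + 1 + b 0 + 1) * (-(((y : ℚ) + 1 + k) * (((y : ℚ) + 1 + 1) - 1) * A *
        (((y + k).factorial : ℚ) * (-1 : ℚ) ^ (y + 1)))) *
      ((k.factorial : ℚ) * (y.factorial : ℚ) * pochQ ((y : ℚ) + 1 + b 0 + 1) (y + 1 + k) *
        (((y : ℚ) + 1 + b 0 + 1 + ((y : ℚ) + 1 + k)) * ((y : ℚ) + 1 + b 0 + 2 + ((y : ℚ) + 1 + k)) *
          ((k : ℚ) + 1) * ((k : ℚ) + 2) * (2 * ((y : ℚ) + 1) + b 0)))) * hK -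
    ((2 * ((y : ℚ) + 1) + b 0) * A *
      (((y + k).factorial : ℚ) * ((-1 : ℚ) ^ y * kernel5 b (y + 1)) *
        (((y : ℚ) + 1 + k) * (((y : ℚ) + 1) + b 0 + 1) * P * ((k : ℚ) + 2))) *
      ((2 * ((y : ℚ) + 1 + 1) + b 0) * (((y : ℚ) + 1) * (y.factorial : ℚ)) * (((k : ℚ) + 1) * (k.factorial : ℚ)))) * hP

/-- **Interior column** `x = y+1 ≤ μ = y+1+k` of the termwise WZ identity. -/
theorem wz_col_interior (hB : ∀ j ∈ Icc 3 6, 0 ≤ b j ∧ b j ≤ b 0) :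
    kerP2 b (y + 1 + k) * wzF b (y + 1 + k + 2) (y + 1) + kerP1 b (y + 1 + k) * wzF b (y + 1 + k + 1) (y + 1) +
        kerP0 b (y + 1 + k) * wzF b (y + 1 + k) (y + 1) = wzG b (y + 1 + k) (y + 1 + 1) - wzG b (y + 1 + k) (y + 1) := by
  rw [wzF_unit0 b hN, wzF_unit1 b hN, wzF_unit2 b hN, wzG_unit0 b hN, wzG_unit1 b hN y k hB]
  have h := recK_interior_cleared (K := ℚ) ((y : ℚ) + 1) ((y : ℚ) + 1 + k) (b 0) (b 3) (b 4) (b 5) (b 6)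
  dsimp only at h
  simp only [kerP2, kerP1, kerP0, esB1, esB2, esB3]
  push_cast
  linear_combination wzUnit b y k * h

end interior

/-- STATEMENT (interior columns of the termwise WZ identity; PROVED here as `wz_col_interior_holds`). -/
def wz_col_interior_stmt : Prop :=
  ∀ b : ℕ → ℤ, 0 ≤ b 0 → ∀ y k : ℕ, (∀ j ∈ Icc 3 6, 0 ≤ b j ∧ b j ≤ b 0) →
    kerP2 b (y + 1 + k) * wzF b (y + 1 + k + 2) (y + 1) + kerP1 b (y + 1 + k) * wzF b (y + 1 + k + 1) (y + 1) +
        kerP0 b (y + 1 + k) * wzF b (y + 1 + k) (y + 1) = wzG b (y + 1 + k) (y + 1 + 1) - wzG b (y + 1 + k) (y + 1)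

/-- The interior columns hold. -/
theorem wz_col_interior_holds : wz_col_interior_stmt := fun b hN y k hB => wz_col_interior b hN y k hB

end Summit.KontsevichZagierPeriods.Zeta5Search.WedgeDictionary
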